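import Summits.Ventures.WeilGRH.TwistedSechDensity
import Mathlib.Analysis.SpecialFunctions.Gamma.Basic
import HarnessLib

/-!
# GRH arm (rh-explicit, venture WeilGRH): the `sech` density as an exponential series — a finite expansion
  with explicit remainder for the `sech` block of odd characters

Cell `rh-explicit`, WEIL TRACK — GRH ARM (typing seat weil-grh-1).  The entries `sechIncrCoeff a n m` of the odd
Gram objects (`TwistedGramOddReal.lean`) are integrals of `σ(t) = 1/(2cosh(t/2))` against Yoshida's increment
kernel on `(0, 2a]`, with no closed form.  For CERTIFICATES (exact / interval arithmetic) we type the finite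
exponential expansion with an explicit remainder:

* `sech_density_sub_partial_sum`: for every real `t` and `K`,
  `σ(t) − Σ_{k<K} (−1)^k e^{−(k+½)t} = (−1)^K e^{−(K+½)t}/(1 + e^{−t})`, so `|σ − S_K| ≤ e^{−(K+½)t}`;
* `abs_integral_sech_mul_sub_sum_le`: for a measurable `F` with `|F(t)| ≤ C·t` on `(0, T]` (Yoshida's kernels
  vanish to first order at `t = 0`),
  `|∫_{(0,T]} σ F − Σ_{k<K} (−1)^k ∫_{(0,T]} e^{−(k+½)t} F(t) dt| ≤ C/(K+½)²`.

Each term `∫_{(0,T]} e^{−(k+½)t} F(t) dt` is elementary for the trigonometric-polynomial kernels (`T = 2a`,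
`e^{−(k+½)·2a} = 3^{−k}/√3` at `a = (log 3)/2`), so `sechIncrCoeff` is a finite elementary sum up to a certified
`O(K⁻²)` tail.  No definitions; no named facts; RH/GRH-free.
-/

set_option autoImplicit false

noncomputable section

open Filter Set MeasureTheory
open scoped Real Topology

namespace Summit.Ventures.WeilGRH

/-! ## The finite expansion of `σ` -/

/-- **`σ(t) − Σ_{k<K} (−1)^k e^{−(k+½)t} = (−1)^K e^{−(K+½)t}/(1 + e^{−t})`** (all real `t`). -/
theorem sech_density_sub_partial_sum (t : ℝ) (K : ℕ) :
    1 / (2 * Real.cosh (t / 2)) - ∑ k ∈ Finset.range K, (-1 : ℝ) ^ k * Real.exp (-((k + 1 / 2) * t)) =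
      (-1 : ℝ) ^ K * Real.exp (-((K + 1 / 2) * t)) / (1 + Real.exp (-t)) := by
  have hpos : 0 < 1 + Real.exp (-t) := by positivity
  have hσ : 1 / (2 * Real.cosh (t / 2)) = Real.exp (-(t / 2)) / (1 + Real.exp (-t)) := by
    rw [Real.cosh_eq, div_eq_div_iff (by positivity) hpos.ne', one_mul]
    have : Real.exp (-(t / 2)) * Real.exp (t / 2) = 1 := by rw [← Real.exp_add]; simp
    have h2 : Real.exp (-(t / 2)) * Real.exp (-(t / 2)) = Real.exp (-t) := by rw [← Real.exp_add]; ring_nf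
    nlinarith [this, h2]
  -- geometric sum with ratio `r = −e^{−t}`
  have hterm : ∀ k : ℕ, (-1 : ℝ) ^ k * Real.exp (-((k + 1 / 2) * t)) =
      Real.exp (-(t / 2)) * (-Real.exp (-t)) ^ k := by
    intro k
    rw [neg_pow (Real.exp (-t)) k, ← Real.exp_nat_mul, show -((k + 1 / 2 : ℝ) * t) = -(t / 2) + k * -t by ring,
      Real.exp_add]
    ring
  have hK : (-1 : ℝ) ^ K * Real.exp (-((K + 1 / 2) * t)) = Real.exp (-(t / 2)) * ((-1 : ℝ) ^ K * Real.exp (K * -t)) := by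
    rw [show -((K + 1 / 2 : ℝ) * t) = -(t / 2) + K * -t by ring, Real.exp_add]; ring
  rw [Finset.sum_congr rfl fun k _ ↦ hterm k, ← Finset.mul_sum,
    geom_sum_eq (by nlinarith [Real.exp_pos (-t)] : -Real.exp (-t) ≠ 1), hσ, hK,
    neg_pow (Real.exp (-t)) K, ← Real.exp_nat_mul, show (-Real.exp (-t) - 1) = -(1 + Real.exp (-t)) by ring]
  field_simp
  ring

/-- `|σ(t) − S_K(t)| ≤ e^{−(K+½)t}`. -/
theorem abs_sech_density_sub_partial_sum_le (t : ℝ) (K : ℕ) :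
    |1 / (2 * Real.cosh (t / 2)) - ∑ k ∈ Finset.range K, (-1 : ℝ) ^ k * Real.exp (-((k + 1 / 2) * t))| ≤
      Real.exp (-((K + 1 / 2) * t)) := by
  rw [sech_density_sub_partial_sum, abs_div, abs_mul, abs_pow, abs_neg, abs_one, one_pow, one_mul,
    Real.abs_exp, abs_of_pos (by positivity : 0 < 1 + Real.exp (-t))]
  exact div_le_self (Real.exp_pos _).le (by linarith [Real.exp_pos (-t)])

/-! ## Termwise integration against a kernel vanishing to first order at `0` -/

/-- `∫₀^∞ t e^{−ct} dt = 1/c²` (`c > 0`). -/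
theorem integral_mul_exp_neg_mul_Ioi {c : ℝ} (hc : 0 < c) :
    ∫ t in Ioi (0 : ℝ), t * Real.exp (-(c * t)) = 1 / c ^ 2 := by
  have h := Real.integral_rpow_mul_exp_neg_mul_Ioi (a := 2) (r := c) (by norm_num) hc
  rw [show (2 : ℝ) - 1 = 1 by norm_num, Real.Gamma_two, mul_one, Real.rpow_two,
    show (1 / c) ^ 2 = 1 / c ^ 2 by ring] at h
  rw [← h]
  refine setIntegral_congr_fun measurableSet_Ioi fun t _ ↦ ?_
  rw [Real.rpow_one]

/-- `t ↦ t e^{−ct}` is integrable on `(0, ∞)` (`c > 0`). -/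
theorem integrableOn_mul_exp_neg_mul_Ioi {c : ℝ} (hc : 0 < c) :
    IntegrableOn (fun t : ℝ ↦ t * Real.exp (-(c * t))) (Ioi 0) := by
  have h : ∫ t in Ioi (0 : ℝ), t * Real.exp (-(c * t)) ≠ 0 := by
    rw [integral_mul_exp_neg_mul_Ioi hc]; positivity
  exact Integrable.of_integral_ne_zero h

/-- **Termwise integration of the `sech` block with an explicit tail**: if `F` is measurable with
`|F(t)| ≤ C·t` on `(0, T]`, then
`|∫_{(0,T]} σ F − Σ_{k<K} (−1)^k ∫_{(0,T]} e^{−(k+½)t} F(t) dt| ≤ C/(K+½)²`. -/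
theorem abs_integral_sech_mul_sub_sum_le {F : ℝ → ℝ} {C T : ℝ} (hF : Measurable F) (hC : 0 ≤ C)
    (hb : ∀ t ∈ Ioc 0 T, |F t| ≤ C * t) (K : ℕ) :
    |(∫ t in Ioc 0 T, 1 / (2 * Real.cosh (t / 2)) * F t) -
        ∑ k ∈ Finset.range K, (-1 : ℝ) ^ k * ∫ t in Ioc 0 T, Real.exp (-((k + 1 / 2) * t)) * F t| ≤
      C / (K + 1 / 2) ^ 2 := by
  rcases le_or_gt T 0 with hT | hT
  · have he : Ioc 0 T = ∅ := Ioc_eq_empty (not_lt.2 hT)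
    simp only [he, Measure.restrict_empty, integral_zero_measure, mul_zero, Finset.sum_const_zero, sub_zero,
      abs_zero]
    positivity
  -- `F` is bounded on `(0, T]`, hence every integrand is integrable there
  have hFb : ∀ t ∈ Ioc 0 T, |F t| ≤ C * T := fun t ht ↦
    (hb t ht).trans (mul_le_mul_of_nonneg_left ht.2 hC)
  have hfin : volume (Ioc 0 T) < ⊤ := by simp [Real.volume_Ioc]
  have hint : ∀ {g : ℝ → ℝ}, Continuous g → (∀ t, |g t| ≤ 1) →
      IntegrableOn (fun t ↦ g t * F t) (Ioc 0 T) := by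
    intro g hg hg1
    refine Measure.integrableOn_of_bounded (M := C * T) hfin.ne ((hg.measurable.mul hF).aestronglyMeasurable)
      ((ae_restrict_iff' measurableSet_Ioc).2 (Eventually.of_forall fun t ht ↦ ?_))
    rw [Real.norm_eq_abs, abs_mul]
    calc |g t| * |F t| ≤ 1 * (C * T) := mul_le_mul (hg1 t) (hFb t ht) (abs_nonneg _) zero_le_one
      _ = C * T := one_mul _
  have hσ1 : ∀ t : ℝ, |1 / (2 * Real.cosh (t / 2))| ≤ 1 := fun t ↦ by
    rw [abs_of_pos (sech_density_pos t)]
    have := Real.one_le_cosh (t / 2)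
    rw [div_le_one (by positivity)]; linarith
  have hek : ∀ k : ℕ, ∀ t : ℝ, t ∈ Ioc 0 T → |Real.exp (-((k + 1 / 2) * t))| ≤ 1 := fun k t ht ↦ by
    rw [Real.abs_exp, Real.exp_le_one_iff]; nlinarith [ht.1]
  have hIσ := hint continuous_sech_density hσ1
  have hIk : ∀ k : ℕ, IntegrableOn (fun t ↦ Real.exp (-((k + 1 / 2) * t)) * F t) (Ioc 0 T) := by
    intro k
    refine Measure.integrableOn_of_bounded (M := C * T) hfin.ne
      (((Real.continuous_exp.comp (by fun_prop)).measurable.mul hF).aestronglyMeasurable)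
      ((ae_restrict_iff' measurableSet_Ioc).2 (Eventually.of_forall fun t ht ↦ ?_))
    rw [Real.norm_eq_abs, abs_mul]
    calc |Real.exp (-((k + 1 / 2) * t))| * |F t| ≤ 1 * (C * T) :=
          mul_le_mul (hek k t ht) (hFb t ht) (abs_nonneg _) zero_le_one
      _ = C * T := one_mul _
  -- the partial sum times `F` is integrable; the difference is the integral of `(σ − S_K) F`
  have hIS : IntegrableOn (fun t ↦ (∑ k ∈ Finset.range K, (-1 : ℝ) ^ k * Real.exp (-((k + 1 / 2) * t))) * F t)
      (Ioc 0 T) := by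
    have : (fun t ↦ (∑ k ∈ Finset.range K, (-1 : ℝ) ^ k * Real.exp (-((k + 1 / 2) * t))) * F t) =
        fun t ↦ ∑ k ∈ Finset.range K, (-1 : ℝ) ^ k * (Real.exp (-((k + 1 / 2) * t)) * F t) := by
      funext t; rw [Finset.sum_mul]; exact Finset.sum_congr rfl fun k _ ↦ by ring
    rw [this]
    exact integrable_finsetSum _ fun k _ ↦ (hIk k).const_mul _
  have hID : IntegrableOn (fun t ↦ (1 / (2 * Real.cosh (t / 2)) -
      ∑ k ∈ Finset.range K, (-1 : ℝ) ^ k * Real.exp (-((k + 1 / 2) * t))) * F t) (Ioc 0 T) :=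
    (hIσ.sub hIS).congr_fun (fun t _ ↦ by simp only [Pi.sub_apply]; ring) measurableSet_Ioc
  have hdiff : (∫ t in Ioc 0 T, 1 / (2 * Real.cosh (t / 2)) * F t) -
      ∑ k ∈ Finset.range K, (-1 : ℝ) ^ k * ∫ t in Ioc 0 T, Real.exp (-((k + 1 / 2) * t)) * F t =
      ∫ t in Ioc 0 T, (1 / (2 * Real.cosh (t / 2)) -
        ∑ k ∈ Finset.range K, (-1 : ℝ) ^ k * Real.exp (-((k + 1 / 2) * t))) * F t := by
    have hsum : ∫ t in Ioc 0 T, (∑ k ∈ Finset.range K, (-1 : ℝ) ^ k * Real.exp (-((k + 1 / 2) * t))) * F t =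
        ∑ k ∈ Finset.range K, (-1 : ℝ) ^ k * ∫ t in Ioc 0 T, Real.exp (-((k + 1 / 2) * t)) * F t := by
      rw [show (∑ k ∈ Finset.range K, (-1 : ℝ) ^ k * ∫ t in Ioc 0 T, Real.exp (-((k + 1 / 2) * t)) * F t) =
          ∑ k ∈ Finset.range K, ∫ t in Ioc 0 T, (-1 : ℝ) ^ k * (Real.exp (-((k + 1 / 2) * t)) * F t) from
          Finset.sum_congr rfl fun k _ ↦ (integral_const_mul _ _).symm,
        ← integral_finsetSum _ (fun k _ ↦ (hIk k).const_mul ((-1 : ℝ) ^ k))]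
      refine setIntegral_congr_fun measurableSet_Ioc fun t _ ↦ ?_
      rw [Finset.sum_mul]
      exact Finset.sum_congr rfl fun k _ ↦ by ring
    rw [← hsum, ← integral_sub hIσ hIS]
    refine setIntegral_congr_fun measurableSet_Ioc fun t _ ↦ ?_
    ring
  rw [hdiff]
  -- bound by `∫_{(0,T]} C t e^{−(K+½)t} ≤ ∫₀^∞ C t e^{−(K+½)t} = C/(K+½)²`
  have hc : (0 : ℝ) < K + 1 / 2 := by positivity
  have hdom : IntegrableOn (fun t : ℝ ↦ C * (t * Real.exp (-((K + 1 / 2) * t)))) (Ioi 0) :=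
    (integrableOn_mul_exp_neg_mul_Ioi hc).const_mul C
  calc |∫ t in Ioc 0 T, (1 / (2 * Real.cosh (t / 2)) -
          ∑ k ∈ Finset.range K, (-1 : ℝ) ^ k * Real.exp (-((k + 1 / 2) * t))) * F t|
      ≤ ∫ t in Ioc 0 T, C * (t * Real.exp (-((K + 1 / 2) * t))) := by
        rw [← Real.norm_eq_abs]
        refine (norm_integral_le_integral_norm _).trans
          (setIntegral_mono_on hID.norm (hdom.mono_set Ioc_subset_Ioi_self) measurableSet_Ioc fun t ht ↦ ?_)
        rw [Real.norm_eq_abs, abs_mul]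
        calc |1 / (2 * Real.cosh (t / 2)) - ∑ k ∈ Finset.range K, (-1 : ℝ) ^ k * Real.exp (-((k + 1 / 2) * t))| *
              |F t| ≤ Real.exp (-((K + 1 / 2) * t)) * (C * t) :=
            mul_le_mul (abs_sech_density_sub_partial_sum_le t K) (hb t ht) (abs_nonneg _) (Real.exp_pos _).le
          _ = C * (t * Real.exp (-((K + 1 / 2) * t))) := by ring
    _ ≤ ∫ t in Ioi 0, C * (t * Real.exp (-((K + 1 / 2) * t))) :=
        setIntegral_mono_set hdom
          ((ae_restrict_iff' measurableSet_Ioi).2 (Eventually.of_forall fun t (ht : 0 < t) ↦ by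
            have := Real.exp_pos (-((K + 1 / 2 : ℝ) * t)); positivity))
          Ioc_subset_Ioi_self.eventuallyLE
    _ = C / (K + 1 / 2) ^ 2 := by
        rw [integral_const_mul, integral_mul_exp_neg_mul_Ioi hc]; ring

end Summit.Ventures.WeilGRH

end
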